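import Literature.Probability.RandomPlanarGeometry.LoewnerHullConnected
import Literature.Probability.RandomPlanarGeometry.LoewnerMapProofs
import Literature.Probability.RandomPlanarGeometry.LoewnerInverse
import Literature.Probability.RandomPlanarGeometry.RestrictionSemigroup
import Literature.Probability.RandomPlanarGeometry.CaratheodoryHalfPlane
import Literature.Probability.RandomPlanarGeometry.HullApproximation
import Literature.Probability.RandomPlanarGeometry.ArcHullDomains
import Literature.Topology.PlaneTopology.Janiszewski
import HarnessLib

/-!
# Slid hulls `g_t(A) - W_t` are `*`-hulls, for every continuous driving function

[LSW] §5 ("Suppose that `A ∈ 𝒬*` is fixed … For `t < T`, let `A_t = g_t(A)` … `h_t = g_{A_t}`")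
uses the normalized conformal maps of the hulls `A_t = g_t(A)` before the hitting time `T` of
`A`; in the tree's vocabulary this requires the slid hull `A_t - W_t = slidHull W A t`
(`SLERestrictionMartingale`) to be a `*`-hull (`IsStarHull`), which `SLERestrictionSlidHull`
proves for chains generated by a SIMPLE CURVE. Lemma 6.3 of

* G. F. Lawler, O. Schramm, W. Werner, *Conformal restriction: the chordal case*, J. Amer. Math.
  Soc. **16** (2003) 917–955 (**[LSW]**),

is stated for an arbitrary continuous driving function, so we prove it in that generality:

* `Loewner.isPreconnected_domain_diff` — for a bounded hull `A` missed by the closed hull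
  `K̂_t`, the open set `H_t ∖ A = ℍ ∖ (K_t ∪ A)` is connected: **Janiszewski's theorem**
  (`Literature.Topology.PlaneTopology.janiszewski'`) after the Cayley transform `c : ℍ → 𝔻`
  (`cayleyFun`), for the compact sets `c(A) ∪ ∂𝔻` and `c(K̂_t) ∪ ∂𝔻`, which meet exactly in the
  connected circle `∂𝔻` and separately separate no two points of `c(H_t ∖ A)` (`ℍ ∖ A` and
  `H_t` being connected);
* `Loewner.isSimplyConnected_domain_diff` — hence `H_t ∖ A` is simply connected (Conway's
  criterion `isSimplyConnected_of_isConnected_compl_holds`: its complement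
  `(K̂_t ∪ {im ≤ 0}) ∪ (A ∪ {im ≤ 0})` is connected by
  `Loewner.isConnected_closedHull_union_im_nonpos` and
  `IsBoundedHull.isConnected_union_im_nonpos`, and unbounded);
* `Loewner.isStarHull_slidHull_of_disjoint` — **for `A ∈ 𝒬*` with `K̂_t ∩ A = ∅` the slid hull
  `g_t(A) - W_t` is a `*`-hull**: the points of `A` are still flowing at time `t`, where `g_t`
  is continuous and injective (`continuousAt_map`, `injOn_map_of_lt_swallowingTime`), real on
  real points and `ℍ`-valued on `ℍ`, never equal to `W_t`; and `ℍ ∖ (g_t(A) - W_t)` is the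
  conformal image of `H_t ∖ A` under `g_t - W_t` (as in the simple-curve proof of
  `SLERestrictionSlidHull`, whose bookkeeping is repeated here).
-/

noncomputable section

open Set Filter Metric Complex
open _root_.Topology
open UpperHalfPlane (upperHalfPlaneSet isOpen_upperHalfPlaneSet)
open scoped NNReal

namespace Literature.Probability.RandomPlanarGeometry

namespace Loewner

variable {W : ℝ≥0 → ℝ} {A : Set ℂ} {t : ℝ≥0}

/-! ### Points of a hull missed by the closed hull are still flowing -/

/-- If the closed hull `K̂_t` misses `A ⊆ ℍ̄`, every point of `A` is still flowing at time `t`. [folklore] -/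
theorem lt_swallowingTime_of_disjoint_closedHull (hA : A ⊆ closure upperHalfPlaneSet)
    (hdisj : Disjoint (closedHull W t) A) {a : ℂ} (ha : a ∈ A) :
    (t : WithTop ℝ≥0) < swallowingTime W a := by
  have him : 0 ≤ a.im := by
    have := hA ha
    rwa [show upperHalfPlaneSet = {z : ℂ | 0 < z.im} from rfl, Complex.closure_setOf_lt_im] at this
  by_contra hle
  rw [not_lt] at hle
  exact Set.disjoint_left.1 hdisj ⟨him, hle⟩ ha

/-! ### `H_t ∖ A` is connected: Janiszewski after the Cayley transform -/

/-- **`H_t ∖ A` is connected** for a bounded hull `A` missed by the closed hull `K̂_t`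
(continuous driving function): Janiszewski's theorem for `c(A) ∪ ∂𝔻` and `c(K̂_t) ∪ ∂𝔻`, `c`
the Cayley transform (injective on `ℍ̄`, `cayleyFun_injOn` of `ArcHullDomains`). [folklore] -/
theorem isPreconnected_domain_diff (hW : Continuous W) (hA : IsBoundedHull A)
    (hdisj : Disjoint (closedHull W t) A) : IsPreconnected (domain W t \ A) := by
  set K : Set ℂ := closedHull W t with hK
  set c : ℂ → ℂ := cayleyFun with hc
  have hKc : IsCompact K := isCompact_closedHull hW t
  have hAc : IsCompact A := hA.isCompact
  have hKim : K ⊆ {z : ℂ | 0 ≤ z.im} := fun z hz ↦ hz.1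
  have hAim : A ⊆ {z : ℂ | 0 ≤ z.im} := fun z hz ↦ by
    have := hA.subset_closure hz
    rwa [show upperHalfPlaneSet = {z : ℂ | 0 < z.im} from rfl, Complex.closure_setOf_lt_im] at this
  have hHim : upperHalfPlaneSet ⊆ {z : ℂ | 0 ≤ z.im} := fun z hz ↦ by
    have hz' : 0 < z.im := hz
    exact hz'.le
  have hcont : ContinuousOn c {z : ℂ | 0 ≤ z.im} :=
    continuousOn_cayleyFun.mono fun z hz ↦ add_I_ne_zero hz
  have hnormH : ∀ z ∈ upperHalfPlaneSet, ‖c z‖ < 1 := fun z hz ↦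
    (norm_cayleyFun_lt_one_iff (add_I_ne_zero (le_of_lt hz))).2 hz
  -- the two compact sets and their intersection, the unit circle
  set S₁ : Set ℂ := c '' A ∪ sphere 0 1 with hS₁
  set S₂ : Set ℂ := c '' K ∪ sphere 0 1 with hS₂
  have hS₁c : IsCompact S₁ := (hAc.image_of_continuousOn (hcont.mono hAim)).union (isCompact_sphere 0 1)
  have hS₂c : IsCompact S₂ := (hKc.image_of_continuousOn (hcont.mono hKim)).union (isCompact_sphere 0 1)
  have hinter : S₁ ∩ S₂ = sphere 0 1 := by
    refine Subset.antisymm ?_ fun w hw ↦ ⟨Or.inr hw, Or.inr hw⟩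
    rintro w ⟨h₁ | h₁, h₂ | h₂⟩
    · exfalso
      obtain ⟨a, ha, rfl⟩ := h₁
      obtain ⟨k, hk, hka⟩ := h₂
      have : k = a := cayleyFun_injOn (hKim hk) (hAim ha) hka
      exact Set.disjoint_left.1 hdisj hk (this ▸ ha)
    · exact h₂
    · exact h₁
    · exact h₁
  have hinterc : IsPreconnected (S₁ ∩ S₂) := by
    rw [hinter]
    exact isPreconnected_sphere (by rw [Complex.rank_real_complex]; exact Cardinal.one_lt_two) 0 1
  -- images of `ℍ ∖ A` and of `H_t` avoid `S₁`, resp. `S₂`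
  have hHA : c '' (upperHalfPlaneSet \ A) ⊆ S₁ᶜ := by
    rintro _ ⟨z, hz, rfl⟩ (⟨a, ha, haz⟩ | h)
    · have : a = z := cayleyFun_injOn (hAim ha) (hHim hz.1) haz
      exact hz.2 (this ▸ ha)
    · have h1 := hnormH z hz.1
      rw [mem_sphere_zero_iff_norm] at h
      exact (ne_of_lt h1) h
  have hHK : c '' domain W t ⊆ S₂ᶜ := by
    rintro _ ⟨z, hz, rfl⟩ (⟨k, hk, hkz⟩ | h)
    · have hzH := domain_subset W t hz
      have : k = z := cayleyFun_injOn (hKim hk) (hHim hzH) hkz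
      rw [this] at hk
      exact lt_irrefl _ (((mem_domain_iff W t z).1 hz).2.trans_le hk.2)
    · have h1 := hnormH z (domain_subset W t hz)
      rw [mem_sphere_zero_iff_norm] at h
      exact (ne_of_lt h1) h
  have hHAc : IsPreconnected (c '' (upperHalfPlaneSet \ A)) :=
    hA.2.2.isPathConnected.isConnected.isPreconnected.image _ (hcont.mono fun z hz ↦ hHim hz.1)
  have hHKc : IsPreconnected (c '' domain W t) :=
    ((conformalEquivMap hW t).isSimplyConnected_iff.2
      isSimplyConnected_upperHalfPlaneSet).isPathConnected.isConnected.isPreconnected.image _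
      (hcont.mono fun z hz ↦ hHim (domain_subset W t hz))
  -- any two points are joined
  refine isPreconnected_of_forall_pair fun x hx y hy ↦ ?_
  have hxH : x ∈ upperHalfPlaneSet := domain_subset W t hx.1
  have hyH : y ∈ upperHalfPlaneSet := domain_subset W t hy.1
  obtain ⟨S₃, hS₃, hS₃c, hx₃, hy₃⟩ := Literature.Topology.PlaneTopology.janiszewski' hS₁c hS₂c hinterc
    ⟨c '' (upperHalfPlaneSet \ A), hHA, hHAc, ⟨x, ⟨hxH, hx.2⟩, rfl⟩, ⟨y, ⟨hyH, hy.2⟩, rfl⟩⟩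
    ⟨c '' domain W t, hHK, hHKc, ⟨x, hx.1, rfl⟩, ⟨y, hy.1, rfl⟩⟩
  -- `S₃` stays inside the disc (it misses the circle and contains `c x`)
  have hS₃ball : S₃ ⊆ ball 0 1 := by
    have hcov : S₃ ⊆ ball 0 1 ∪ (closedBall 0 1)ᶜ := fun w hw ↦ by
      have hws : w ∉ sphere (0 : ℂ) 1 := fun h ↦ hS₃ hw (Or.inl (Or.inr h))
      rcases lt_or_gt_of_ne (fun h ↦ hws (mem_sphere_zero_iff_norm.2 h)) with h | h
      · exact Or.inl (mem_ball_zero_iff.2 h)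
      · refine Or.inr fun h' ↦ ?_
        rw [mem_closedBall_zero_iff] at h'
        linarith
    have hdj : Disjoint (ball (0 : ℂ) 1) (closedBall 0 1)ᶜ :=
      Set.disjoint_left.2 fun w hw hw' ↦ hw' (ball_subset_closedBall hw)
    rcases hS₃c.subset_or_subset isOpen_ball isClosed_closedBall.isOpen_compl hdj hcov with h | h
    · exact h
    · exact absurd (ball_subset_closedBall (mem_ball_zero_iff.2 (hnormH x hxH))) (h hx₃)
  -- pull back by the inverse Cayley transform
  have hcont' : ContinuousOn cayleyInvFun (ball 0 1) :=
    differentiableOn_cayleyInvFun.continuousOn.mono fun w hw ↦ by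
      rintro rfl
      simp at hw
  refine ⟨cayleyInvFun '' S₃, ?_, ?_, ?_, hS₃c.image _ (hcont'.mono hS₃ball)⟩
  · rintro _ ⟨w, hw, rfl⟩
    have hwb : w ∈ ball (0 : ℂ) 1 := hS₃ball hw
    have hw1 : w ≠ 1 := by rintro rfl; simp at hwb
    have hzH : 0 < (cayleyInvFun w).im := cayleyInvFun_im_pos (mem_ball_zero_iff.1 hwb)
    have hcz : c (cayleyInvFun w) = w := cayleyFun_cayleyInvFun hw1
    refine ⟨(mem_domain_iff W t _).2 ⟨hzH, not_le.1 fun hle ↦ ?_⟩, fun hzA ↦ ?_⟩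
    · exact hS₃ hw (Or.inr (Or.inl ⟨_, ⟨hzH.le, hle⟩, hcz⟩))
    · exact hS₃ hw (Or.inl (Or.inl ⟨_, hzA, hcz⟩))
  · exact ⟨c x, hx₃, cayleyInvFun_cayleyFun (add_I_ne_zero (le_of_lt hxH))⟩
  · exact ⟨c y, hy₃, cayleyInvFun_cayleyFun (add_I_ne_zero (le_of_lt hyH))⟩

/-- Far up the imaginary axis there are points of `H_t ∖ A`. [folklore] -/
theorem nonempty_domain_diff (hW : Continuous W) (hA : Bornology.IsBounded A) :
    (domain W t \ A).Nonempty := by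
  obtain ⟨M, hM0, hM⟩ := exists_forall_norm_driving_sub_le hW t 0
  obtain ⟨δ, hδ, hδt, -⟩ := exists_delta t one_pos
  obtain ⟨R, hR⟩ := hA.subset_closedBall 0
  set z : ℂ := ((M + 2 * δ + |R| + 1 : ℝ) : ℂ) * Complex.I with hz
  have hzn : ‖z‖ = M + 2 * δ + |R| + 1 := by
    rw [hz, norm_mul, norm_real, norm_I, mul_one, Real.norm_eq_abs, abs_of_pos (by positivity)]
  have hzH : z ∈ upperHalfPlaneSet := by
    show 0 < z.im
    simp [hz]
    positivity
  refine ⟨z, mem_domain_of_far hW hM hδ hδt hzH ?_, fun hzA ↦ ?_⟩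
  · rw [sub_zero, hzn]
    linarith [abs_nonneg R]
  · have := hR hzA
    rw [mem_closedBall, dist_zero_right, hzn] at this
    linarith [le_abs_self R]

/-- **`H_t ∖ A` is simply connected** for a bounded hull `A` missed by `K̂_t` (continuous
driving function): it is open and connected, and its complement
`(K̂_t ∪ {im ≤ 0}) ∪ (A ∪ {im ≤ 0})` is connected and unbounded (Conway's criterion).
[folklore] -/
theorem isSimplyConnected_domain_diff (hW : Continuous W) (hA : IsBoundedHull A)
    (hdisj : Disjoint (closedHull W t) A) : IsSimplyConnected (domain W t \ A) := by
  set L : Set ℂ := {z : ℂ | z.im ≤ 0} with hL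
  have hopen : IsOpen (domain W t \ A) := (isOpen_domain hW t).sdiff hA.isClosed
  have hconn : IsConnected (domain W t \ A) :=
    ⟨nonempty_domain_diff hW hA.1, isPreconnected_domain_diff hW hA hdisj⟩
  have hcompl : (domain W t \ A)ᶜ = (closedHull W t ∪ L) ∪ (A ∪ L) := by
    ext z
    simp only [mem_compl_iff, Set.mem_sdiff, mem_union, not_and, not_not, mem_domain_iff]
    constructor
    · intro h
      by_cases hzA : z ∈ A
      · exact Or.inr (Or.inl hzA)
      · by_cases hzim : 0 < z.im
        · have hle : swallowingTime W z ≤ (t : WithTop ℝ≥0) := by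
            by_contra hlt
            exact hzA (h ⟨hzim, not_le.1 hlt⟩)
          exact Or.inl (Or.inl ⟨hzim.le, hle⟩)
        · exact Or.inl (Or.inr (not_lt.1 hzim))
    · rintro ((hzK | hzL) | (hzA | hzL)) ⟨hzim, hzt⟩
      · exact absurd (hzt.trans_le hzK.2) (lt_irrefl _)
      · exact absurd (show 0 < z.im from hzim) (not_lt.2 hzL)
      · exact hzA
      · exact absurd (show 0 < z.im from hzim) (not_lt.2 hzL)
  refine isSimplyConnected_of_isConnected_compl_holds hopen hconn ?_ ?_
  · rw [hcompl]
    have h0L : (0 : ℂ) ∈ L := by simp [hL]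
    refine IsConnected.union ⟨0, Or.inr h0L, Or.inr h0L⟩ ?_ ?_
    · exact isConnected_closedHull_union_im_nonpos hW t
    · exact hA.isConnected_union_im_nonpos
  · rw [hcompl]
    intro hb
    obtain ⟨R, hR⟩ := (hb.subset (show L ⊆ (closedHull W t ∪ L) ∪ (A ∪ L) from
      fun z hz ↦ Or.inl (Or.inr hz))).subset_closedBall 0
    have := hR (show (-((|R| + 1 : ℝ) : ℂ) * Complex.I) ∈ L by
      simp only [hL, mem_setOf_eq, neg_mul, Complex.neg_im, Complex.mul_im, Complex.ofReal_re,
        Complex.I_im, mul_one, Complex.ofReal_im, Complex.I_re, mul_zero, add_zero]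
      linarith [abs_nonneg R])
    rw [mem_closedBall_zero_iff, norm_mul, norm_neg, Complex.norm_real, Complex.norm_I, mul_one,
      Real.norm_of_nonneg (by positivity)] at this
    linarith [le_abs_self R]

/-! ### The slid hull is a `*`-hull -/

/-- **The slid hull `g_t(A) - W_t` of a `*`-hull missed by `K̂_t` is a `*`-hull**, for every
continuous driving function ([LSW] §5: `A_t = g_t(A) ∈ 𝒬*` for `t < T`, there for the Brownian
driver; `SLERestrictionSlidHull` for simple curves). [cite: LawlerSchrammWerner2003Restriction, §5 (A_t = g_t(A), t < T)] -/
theorem isStarHull_slidHull_of_disjoint (hW : Continuous W) (hA : IsStarHull A)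
    (hdisj : Disjoint (closedHull W t) A) : IsStarHull (slidHull W A t) := by
  classical
  have hAb := hA.isBoundedHull
  have hAcpt : IsCompact A := hAb.isCompact
  set g : ℂ → ℂ := map W t with hg
  set c : ℂ := (W t : ℂ) with hc
  set B : Set ℂ := slidHull W A t with hB
  have hBdef : B = (fun a ↦ g a - c) '' A := rfl
  -- every point of `A` is still flowing
  have hAT : ∀ a ∈ A, (t : WithTop ℝ≥0) < swallowingTime W a := fun a ha ↦
    lt_swallowingTime_of_disjoint_closedHull hAb.subset_closure hdisj ha
  have him0 : ∀ a ∈ A, 0 ≤ a.im := fun a ha ↦ by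
    have := hAb.subset_closure ha
    rwa [show upperHalfPlaneSet = {z : ℂ | 0 < z.im} from rfl, Complex.closure_setOf_lt_im] at this
  -- continuity and injectivity of `g` on `A`, values
  have hcontA : ContinuousOn (fun a ↦ g a - c) A := fun a ha ↦
    ((continuousAt_map hW (hAT a ha)).sub continuousAt_const).continuousWithinAt
  have hinj : InjOn g {z : ℂ | (t : WithTop ℝ≥0) < swallowingTime W z} :=
    injOn_map_of_lt_swallowingTime hW t
  have hreal : ∀ a ∈ A, a.im = 0 → (g a).im = 0 ∧ g a ≠ c := by
    intro a ha ha0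
    obtain ⟨G, hG⟩ := exists_isSolution_swallowingTime_holds hW (ne_driving_of_lt_swallowingTime (hAT a ha))
    have hmap : g a = G t := map_eq_of_isSolution hW hG (hAT a ha)
    have htT : ((t : ℝ).toNNReal : WithTop ℝ≥0) < swallowingTime W a := by
      rw [Real.toNNReal_coe]; exact hAT a ha
    refine ⟨?_, ?_⟩
    · rw [hmap]
      exact IsSolution.im_eq_zero_holds hG ha0 t t.2 htT
    · rw [hmap, hc]
      have := hG.ne t.2 htT
      simpa [Real.toNNReal_coe] using this
  have hpos : ∀ a ∈ A, 0 < a.im → 0 < (g a).im := fun a ha hapos ↦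
    mapsTo_map hW t ((mem_domain_iff W t a).2 ⟨hapos, hAT a ha⟩)
  have hBcpt : IsCompact B := hAcpt.image_of_continuousOn hcontA
  -- the part in `ℍ`
  have hBH : B ∩ upperHalfPlaneSet = (fun a ↦ g a - c) '' (A ∩ upperHalfPlaneSet) := by
    ext b
    constructor
    · rintro ⟨⟨a, ha, rfl⟩, hb⟩
      refine ⟨a, ⟨ha, ?_⟩, rfl⟩
      rcases (him0 a ha).lt_or_eq with h | h
      · exact h
      · exfalso
        have : (g a - c).im = 0 := by
          rw [Complex.sub_im, (hreal a ha h.symm).1, hc, Complex.ofReal_im, sub_zero]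
        exact absurd this (ne_of_gt hb)
    · rintro ⟨a, ⟨ha, haH⟩, rfl⟩
      refine ⟨⟨a, ha, rfl⟩, ?_⟩
      show 0 < (g a - c).im
      rw [Complex.sub_im, hc, Complex.ofReal_im, sub_zero]
      exact hpos a ha haH
  refine ⟨⟨hBcpt.isBounded, ?_, ?_⟩, ?_⟩
  · -- `closure (B ∩ ℍ) = B`
    rw [hBH]
    refine Subset.antisymm (closure_minimal (image_mono inter_subset_left) hBcpt.isClosed) ?_
    rintro _ ⟨a, ha, rfl⟩
    have hacl : a ∈ closure (A ∩ upperHalfPlaneSet) := by rw [hAb.closure_inter_eq]; exact ha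
    exact ((hcontA a ha).mono inter_subset_left).mem_closure_image hacl
  · -- simple connectivity of `ℍ ∖ B`, transported from `H_t ∖ A`
    set S : Set ℂ := domain W t \ A with hS
    have hscS : IsSimplyConnected S := isSimplyConnected_domain_diff hW hAb hdisj
    set G : ConformalEquiv (domain W t) upperHalfPlaneSet := conformalEquivMap hW t with hGdef
    have hV : MapsTo G S (upperHalfPlaneSet \ g '' A) := by
      intro z hz
      refine ⟨mapsTo_map hW t hz.1, ?_⟩
      rintro ⟨a, ha, haz⟩
      have : a = z := hinj (hAT a ha) ((mem_domain_iff W t z).1 hz.1).2 haz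
      exact hz.2 (this ▸ ha)
    have hV' : MapsTo G.symm (upperHalfPlaneSet \ g '' A) S := by
      intro w hw
      refine ⟨G.symm_mapsTo hw.1, fun ha ↦ hw.2 ⟨_, ha, ?_⟩⟩
      exact G.apply_symm_apply hw.1
    have hscV : IsSimplyConnected (upperHalfPlaneSet \ g '' A) :=
      (G.restr S (upperHalfPlaneSet \ g '' A) sdiff_subset sdiff_subset hV hV').isSimplyConnected_iff.1
        hscS
    have htrans : upperHalfPlaneSet \ B = (Homeomorph.addRight (-c)) '' (upperHalfPlaneSet \ g '' A) := by
      ext w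
      simp only [Homeomorph.coe_addRight, image_add_right, neg_neg, mem_preimage, Set.mem_sdiff,
        hBdef, mem_image, not_exists, not_and]
      have hcim : (w + c).im = w.im := by rw [Complex.add_im, hc, Complex.ofReal_im, add_zero]
      constructor
      · rintro ⟨hw, hwB⟩
        exact ⟨by rw [show upperHalfPlaneSet = {z : ℂ | 0 < z.im} from rfl, mem_setOf_eq, hcim]; exact hw,
          fun a ha haw ↦ hwB a ha (by rw [haw, add_sub_cancel_right])⟩
      · rintro ⟨hw, hwB⟩
        refine ⟨by
          rw [show upperHalfPlaneSet = {z : ℂ | 0 < z.im} from rfl, mem_setOf_eq, hcim] at hw; exact hw,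
          fun a ha haw ↦ hwB a ha (by rw [← haw, sub_add_cancel])⟩
    rw [htrans]
    exact (Homeomorph.addRight (-c)).isSimplyConnected_image.2 hscV
  · -- `0 ∉ B`
    rintro ⟨a, ha, ha0⟩
    have ha0' : g a = c := sub_eq_zero.1 ha0
    rcases (him0 a ha).lt_or_eq with h | h
    · have := hpos a ha h
      rw [ha0', hc, Complex.ofReal_im] at this
      exact lt_irrefl _ this
    · exact (hreal a ha h.symm).2 ha0'

/-- In the setting of [LSW] Lemma 6.3 (`τ` the hitting time of `A ∈ 𝒬*` by the closed hulls),
the slid hulls before `τ` are `*`-hulls. [cite: LawlerSchrammWerner2003Restriction, §5 (A_t = g_t(A), t < T)] -/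
theorem IsHullHitTime.isStarHull_slidHull (hW : Continuous W) (hA : IsStarHull A) {τ : ℝ≥0}
    (h : IsHullHitTime W A τ) (ht : t < τ) : IsStarHull (slidHull W A t) :=
  isStarHull_slidHull_of_disjoint hW hA (h.1 t ht)

end Loewner

end Literature.Probability.RandomPlanarGeometry
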